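import Mathlib
import Summits.RiemannHypothesis.RiemannHypothesis.Theorems.SoloInformedHighPart
import Summits.RiemannHypothesis.RiemannHypothesis.Theorems.SoloInformedEffSampling
import Literature.NumberTheory.LFunctions.WeilExplicitFormulaProofs
import HarnessLib

/-!
# T42c — The low part of the verified-height split

Solo programme `solo-RiemannHypothesis-informed`, claim T42, part (c).  The LOW PART
`G₁ = K ⋆ φ` (`K = g ⋆ g̃`, `φ = ψc ⋆ ψ̃c`, T42a/b) is treated on the ZERO side of the explicit
formula (`explicit_formula_holds`): `W(G₁) = lim_T Σ_{|Im ρ| ≤ T} m(ρ) K̂(ρ) φ̂(ρ)`.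

* At a zero ON the critical line `K̂(ρ) φ̂(ρ) = |ĝ(ρ)|² |ψ̂(ρ)|² ≥ 0`.
* At any zero of the closed strip `|K̂(ρ) φ̂(ρ)| ≤ e^a ‖g‖₁² · D_{k+1}² / |Im ρ|^{2k+2}` with
  `D_{k+1} = ∫ ‖ψc^{(k+1)}‖ e^{|t|/2}` (strip decay of the mollifier, T42a).

Hence under `RHUpTo T₀` (every zero with `0 < Im ρ ≤ T₀` lies on the line — the shape of the
Platt–Trudgian named fact `platt_trudgian_numerical_rh`, which is `RHUpTo 3000175332800`) and
`T₀ ≥ 1`, every partial sum has real part at least `-E` with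
`E = 4 log 2 · A₁ · e^a ‖g‖₁² · D_{k+1}² / T₀^{2k}` (`A₁ = zetaDensityConst`, via the effective
zero-counting majorant `finsum_weilZeroIndex_le_of_kernel_bound_eff`), and so
`Re W(G₁) ≥ -E` (`weilFunctional_lowPart_re_ge`).  One power of `T₀` is given away to the
Cauchy-kernel form of the density bound; the order `k` is free.
-/

open scoped ContDiff ComplexConjugate Real Topology
open Complex MeasureTheory Set Filter Literature.NumberTheory.LFunctions

namespace Summit.RiemannHypothesis.RiemannHypothesis.Theorems

/-- `RHUpTo T₀`: every zero of `ζ` with `0 < Im ρ ≤ T₀` has real part `1/2`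
(the shape of `platt_trudgian_numerical_rh`, with the height as a parameter). -/
def RHUpTo (T₀ : ℝ) : Prop :=
  ∀ s : ℂ, riemannZeta s = 0 → 0 < s.im → s.im ≤ T₀ → s.re = 1 / 2

/-- The Platt–Trudgian named fact is `RHUpTo 3 000 175 332 800`. -/
theorem rhUpTo_of_platt_trudgian (h : platt_trudgian_numerical_rh) : RHUpTo 3000175332800 :=
  fun s hs h0 hT ↦ h s hs h0 hT

/-- `RHUpTo` is monotone in the height. -/
theorem RHUpTo.mono {T₀ T₁ : ℝ} (h : RHUpTo T₀) (hT : T₁ ≤ T₀) : RHUpTo T₁ :=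
  fun s hs h0 h1 ↦ h s hs h0 (h1.trans hT)

/-- The Riemann hypothesis gives `RHUpTo T₀` for every `T₀`. -/
theorem rhUpTo_of_riemannHypothesis (h : RiemannHypothesis) (T₀ : ℝ) : RHUpTo T₀ := by
  intro s hs h0 _
  have him : s.im ≠ 0 := h0.ne'
  refine h s hs ?_ ?_
  · intro ⟨n, hn⟩
    have : s.im = 0 := by rw [hn]; simp
    exact him this
  · intro h1; rw [h1] at him; simp at him

/-- Under `RHUpTo T₀`, a zero of the closed strip with `0 < |Im ρ| ≤ T₀` lies on the line
(conjugation symmetry for `Im ρ < 0`). -/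
theorem RHUpTo.re_eq {T₀ : ℝ} (h : RHUpTo T₀) {ρ : ℂ} (hz : riemannZeta ρ = 0) (him : ρ.im ≠ 0)
    (hle : |ρ.im| ≤ T₀) : ρ.re = 1 / 2 := by
  rcases lt_or_gt_of_ne him with hneg | hpos
  · have hz' : riemannZeta (conj ρ) = 0 := by rw [riemannZeta_conj, hz, map_zero]
    have h1 : 0 < (conj ρ).im := by simp; linarith
    have h2 : (conj ρ).im ≤ T₀ := by
      simp only [Complex.conj_im]; rw [abs_of_neg hneg] at hle; exact hle
    have := h _ hz' h1 h2
    simpa using this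
  · exact h ρ hz hpos (by rwa [abs_of_pos hpos] at hle)

variable {g : ℝ → ℂ} {ψ : ℝ → ℝ} {a δ : ℝ}

/-- `Ĝ₁(s) = K̂(s) φ̂(s)`. -/
theorem weilMellin_lowPart (hg : IsWeilTest g) (hψ : IsMollifier ψ δ) (s : ℂ) :
    weilMellin (lowPart g ψ) s = weilMellin (autoCorr g) s * weilMellin (mollKernel ψ) s := by
  have hK := isWeilTest_autoCorr hg
  have hφ := hψ.isWeilTest_mollKernel
  unfold lowPart
  exact weilMellin_weilConv_holds hK.1.continuous hK.2 hφ.1.continuous hφ.2 s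

/-- On the critical line `Ĝ₁` is a non-negative real: `Re Ĝ₁(1/2 + it) ≥ 0` and in fact
`Ĝ₁(1/2+it) = |ĝ|²|ψ̂|²`. -/
theorem weilMellin_lowPart_half_line (hg : IsWeilTest g) (hψ : IsMollifier ψ δ) (t : ℝ) :
    weilMellin (lowPart g ψ) (1 / 2 + t * I) =
      ((‖weilMellin g (1 / 2 + t * I)‖ ^ 2 * ‖weilMellin (mollC ψ) (1 / 2 + t * I)‖ ^ 2 : ℝ) : ℂ) := by
  rw [weilMellin_lowPart hg hψ, autoCorr, weilMellin_weilConv_weilReflect_half hg,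
    hψ.weilMellin_mollKernel_half_line]
  push_cast; ring

/-- `‖K̂(ρ)‖ ≤ e^a ‖g‖₁²` in the closed strip (`a ≥ 0`). -/
theorem norm_weilMellin_autoCorr_strip_le (hg : IsWeilTest g) (ha : 0 ≤ a)
    (hsupp : tsupport g ⊆ Icc (-a) a) {ρ : ℂ} (h0 : 0 ≤ ρ.re) (h1 : ρ.re ≤ 1) :
    ‖weilMellin (autoCorr g) ρ‖ ≤ Real.exp a * weilNorm1 g ^ 2 := by
  have hN := weilNorm1_nonneg g
  have hb : ∀ s : ℂ, 0 ≤ s.re → s.re ≤ 1 →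
      ‖weilMellin g s‖ ≤ Real.exp (1 / 2 * a) * weilNorm1 g := by
    intro s hs0 hs1
    have h := norm_weilMellin_add_half_le hg hsupp (s - 1 / 2)
    rw [sub_add_cancel] at h
    refine h.trans (mul_le_mul_of_nonneg_right (Real.exp_le_exp.2 ?_) hN)
    have : |(s - 1 / 2).re| ≤ 1 / 2 := by
      rw [abs_le]; simp; constructor <;> linarith
    exact mul_le_mul_of_nonneg_right this ha
  have he : Real.exp (1 / 2 * a) * Real.exp (1 / 2 * a) = Real.exp a := by
    rw [← Real.exp_add]; ring_nf
  unfold autoCorr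
  rw [weilMellin_weilQuadratic hg, norm_mul, Complex.norm_conj]
  have h0' : 0 ≤ (1 - conj ρ).re := by simp; linarith
  have h1' : (1 - conj ρ).re ≤ 1 := by simp; linarith
  calc ‖weilMellin g ρ‖ * ‖weilMellin g (1 - conj ρ)‖
      ≤ (Real.exp (1 / 2 * a) * weilNorm1 g) * (Real.exp (1 / 2 * a) * weilNorm1 g) :=
        mul_le_mul (hb ρ h0 h1) (hb _ h0' h1') (norm_nonneg _) (by positivity)
    _ = Real.exp a * weilNorm1 g ^ 2 := by rw [← he]; ring

/-- The error constant of the low part,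
`E = 4 log 2 · A₁ · (e^a ‖g‖₁²) · D_{k+1}² / T₀^{2k}`. -/
noncomputable def lowErr (g : ℝ → ℂ) (ψ : ℝ → ℝ) (a T₀ : ℝ) (k : ℕ) : ℝ :=
  4 * Real.log 2 * zetaDensityConst * (Real.exp a * weilNorm1 g ^ 2) *
    weilL1 (deriv^[k + 1] (mollC ψ)) ^ 2 / T₀ ^ (2 * k)

/-- `E ≥ 0` for `T₀ ≥ 0`. -/
theorem lowErr_nonneg (g : ℝ → ℂ) (ψ : ℝ → ℝ) (a : ℝ) {T₀ : ℝ} (hT : 0 ≤ T₀) (k : ℕ) :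
    0 ≤ lowErr g ψ a T₀ k := by
  unfold lowErr
  have := zetaDensityConst_pos
  have := weilL1_nonneg (deriv^[k + 1] (mollC ψ))
  have : 0 ≤ Real.log 2 := Real.log_nonneg (by norm_num)
  positivity

/-- **Partial sums.** Under `RHUpTo T₀`, `T₀ ≥ 1`: for every `T`,
`Re Σ_{ρ ∈ weilZeroIndex T} m(ρ) Ĝ₁(ρ) ≥ -E`. -/
theorem re_weilZeroSidePartial_lowPart_ge (hg : IsWeilTest g) (ha : 0 ≤ a)
    (hsupp : tsupport g ⊆ Icc (-a) a) (hψ : IsMollifier ψ δ) {T₀ : ℝ} (hT₀ : 1 ≤ T₀)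
    (hRH : RHUpTo T₀) (k : ℕ) (T : ℝ) :
    -lowErr g ψ a T₀ k ≤ (weilZeroSidePartial (lowPart g ψ) T).re := by
  set A : ℝ := Real.exp a * weilNorm1 g ^ 2 with hA
  set D : ℝ := weilL1 (deriv^[k + 1] (mollC ψ)) with hD
  have hA0 : 0 ≤ A := by positivity
  have hD0 : 0 ≤ D := weilL1_nonneg _
  set M : ℝ := 2 * A * D ^ 2 / T₀ ^ (2 * k) with hM
  have hT₀pos : 0 < T₀ := by linarith
  have hM0 : 0 ≤ M := by positivity
  -- the majorant `F`
  set F : ℂ → ℝ := fun ρ ↦ if T₀ < |ρ.im| then A * D ^ 2 / |ρ.im| ^ (2 * (k + 1)) else 0 with hF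
  have hF0 : ∀ ρ, 0 ≤ F ρ := fun ρ ↦ by
    simp only [hF]; split_ifs <;> positivity
  have hFker : ∀ ρ : ℂ, 0 ≤ ρ.re → ρ.re ≤ 1 → F ρ ≤ M / (1 + (ρ.im - 0) ^ 2) := by
    intro ρ _ _
    rw [sub_zero]
    simp only [hF]
    split_ifs with hγ
    · have hγpos : 0 < |ρ.im| := by linarith
      have hγ1 : 1 ≤ ρ.im ^ 2 := by
        rw [← sq_abs]; nlinarith
      rw [hM, div_le_div_iff₀ (by positivity) (by positivity)]
      -- `A D² (1 + γ²) T₀^{2k} ≤ 2 A D² |γ|^{2k+2}`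
      have hpow : T₀ ^ (2 * k) ≤ |ρ.im| ^ (2 * k) :=
        pow_le_pow_left₀ hT₀pos.le hγ.le _
      have e : |ρ.im| ^ (2 * (k + 1)) = |ρ.im| ^ (2 * k) * ρ.im ^ 2 := by
        rw [show 2 * (k + 1) = 2 * k + 2 by ring, pow_add, sq_abs]
      rw [e]
      have hX : 0 ≤ A * D ^ 2 := by positivity
      have hq : 1 ≤ |ρ.im| ^ (2 * k) / T₀ ^ (2 * k) := by
        rw [le_div_iff₀ (by positivity), one_mul]; exact hpow
      calc A * D ^ 2 * (1 + ρ.im ^ 2)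
          ≤ A * D ^ 2 * (2 * ρ.im ^ 2) * (|ρ.im| ^ (2 * k) / T₀ ^ (2 * k)) := by
            have h1 : A * D ^ 2 * (1 + ρ.im ^ 2) ≤ A * D ^ 2 * (2 * ρ.im ^ 2) :=
              mul_le_mul_of_nonneg_left (by linarith) hX
            have h2 : 0 ≤ A * D ^ 2 * (2 * ρ.im ^ 2) := by positivity
            nlinarith
        _ = 2 * A * D ^ 2 / T₀ ^ (2 * k) * (|ρ.im| ^ (2 * k) * ρ.im ^ 2) := by ring
    · positivity
  have hmaj := finsum_weilZeroIndex_le_of_kernel_bound_eff F M 0 hM0 hFker T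
  rw [abs_zero, zero_add] at hmaj
  -- pointwise comparison
  have hfin := weilZeroIndex_finite T
  have hmem : ∀ ρ, ρ ∈ hfin.toFinset ↔ ρ ∈ weilZeroIndex T := fun ρ ↦ hfin.mem_toFinset
  have hpt : ∀ ρ ∈ hfin.toFinset,
      -((riemannZetaZeroOrder ρ : ℝ) * F ρ) ≤
        ((riemannZetaZeroOrder ρ : ℂ) * weilMellin (lowPart g ψ) ρ).re := by
    intro ρ hρ
    obtain ⟨hz, h0, h1, him, _⟩ := (hmem ρ).1 hρ
    have hm0 : (0 : ℝ) ≤ riemannZetaZeroOrder ρ := by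
      exact_mod_cast riemannZetaZeroOrder_nonneg (fun h ↦ him (by rw [h]; simp))
    rw [← Complex.ofReal_intCast, Complex.re_ofReal_mul]
    by_cases hγ : T₀ < |ρ.im|
    · -- unverified zero: absolute bound
      have hF' : F ρ = A * D ^ 2 / |ρ.im| ^ (2 * (k + 1)) := by simp only [hF, if_pos hγ]
      have hn : ‖weilMellin (lowPart g ψ) ρ‖ ≤ A * D ^ 2 / |ρ.im| ^ (2 * (k + 1)) := by
        rw [weilMellin_lowPart hg hψ, norm_mul]
        have h1' := norm_weilMellin_autoCorr_strip_le hg ha hsupp h0 h1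
        have h2' := hψ.norm_weilMellin_mollKernel_le (k + 1) h0 h1 him
        calc ‖weilMellin (autoCorr g) ρ‖ * ‖weilMellin (mollKernel ψ) ρ‖
            ≤ A * (D ^ 2 / |ρ.im| ^ (2 * (k + 1))) :=
              mul_le_mul h1' h2' (norm_nonneg _) hA0
          _ = A * D ^ 2 / |ρ.im| ^ (2 * (k + 1)) := by ring
      have hre := neg_le_abs (weilMellin (lowPart g ψ) ρ).re
      have habs := Complex.abs_re_le_norm (weilMellin (lowPart g ψ) ρ)
      rw [hF']
      nlinarith
    · -- verified zero: on the line, the term is non-negative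
      push Not at hγ
      have hre : ρ.re = 1 / 2 := hRH.re_eq hz him hγ
      have eρ : ρ = 1 / 2 + ρ.im * I := by
        apply Complex.ext <;> simp [hre]
      have hval : (weilMellin (lowPart g ψ) ρ).re =
          ‖weilMellin g (1 / 2 + ρ.im * I)‖ ^ 2 * ‖weilMellin (mollC ψ) (1 / 2 + ρ.im * I)‖ ^ 2 := by
        rw [eρ, weilMellin_lowPart_half_line hg hψ, Complex.ofReal_re]; simp
      rw [hval]
      have : F ρ = 0 := by simp only [hF, if_neg (not_lt.2 hγ)]
      rw [this, mul_zero, neg_zero]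
      positivity
  -- sum up
  unfold weilZeroSidePartial
  rw [finsum_mem_eq_finite_toFinset_sum _ hfin, Complex.re_sum]
  rw [finsum_mem_eq_finite_toFinset_sum _ hfin] at hmaj
  have hsum := Finset.sum_le_sum hpt
  rw [Finset.sum_neg_distrib] at hsum
  have hE : lowErr g ψ a T₀ k = 2 * zetaDensityConst * M * Real.log 2 := by
    rw [lowErr, hM]; ring
  rw [hE]
  linarith

/-- **The low estimate.** Under `RHUpTo T₀`, `T₀ ≥ 1`: `Re W(G₁) ≥ -E`. -/
theorem weilFunctional_lowPart_re_ge (hg : IsWeilTest g) (ha : 0 ≤ a)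
    (hsupp : tsupport g ⊆ Icc (-a) a) (hψ : IsMollifier ψ δ) {T₀ : ℝ} (hT₀ : 1 ≤ T₀)
    (hRH : RHUpTo T₀) (k : ℕ) :
    -lowErr g ψ a T₀ k ≤ (weilFunctional (lowPart g ψ)).re := by
  have hG₁ := isWeilTest_lowPart hg hψ
  have hlim : Tendsto (fun T ↦ (weilZeroSidePartial (lowPart g ψ) T).re) atTop
      (𝓝 (weilFunctional (lowPart g ψ)).re) :=
    (Complex.continuous_re.tendsto _).comp (explicit_formula_holds hG₁)
  exact ge_of_tendsto' hlim fun T ↦ re_weilZeroSidePartial_lowPart_ge hg ha hsupp hψ hT₀ hRH k T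

end Summit.RiemannHypothesis.RiemannHypothesis.Theorems
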